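import Summits.RiemannHypothesis.RiemannHypothesis.Theses.WeilWindowFlow
import Summits.RiemannHypothesis.RiemannHypothesis.Theorems.WeilWindowFlowStrictUnderRH
import Summits.RiemannHypothesis.RiemannHypothesis.Theorems.WeilWindowFlowStrictArchimedeanBottom
import Summits.RiemannHypothesis.RiemannHypothesis.Theorems.GronwallLeakage.Negative.Structure
import HarnessLib

/-!
# `GronwallLeakage` (crux stmt-RiemannHypothesis-1037) — calibration of the stub `StrictPos`

Line `Sketch` of the crux `GronwallLeakage` (route WeilWindowFlow) cuts the crux as
`StrictPos ∧ LogAC` (landed structure theorem `gronwallLeakage_iff_pos_and_logAC`). This file records,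
sorry-free, what the stub `stub_strictPos` IS:

* `strictPos_iff_riemannHypothesis` — strict positivity of the window bottom `ε = weilGroundEnergy` at
  every window `a > 0` is EQUIVALENT to the Riemann hypothesis: `→` by Yoshida's criterion
  (`riemannHypothesis_iff_forall_weilPositivityOn`, `weilGroundEnergy_nonneg_iff_holds`), `←` by the landed
  route theorem `strictUnderRH_proof` (ground state + explicit formula + Jensen vs. zero counting);
* `gronwallLeakage_iff_riemannHypothesis_and_logAC` — hence the crux is exactly
  `RH ∧ (log ε absolutely continuous on every [b, a] ⊂ (0, ∞))`, by `gronwallLeakage_iff_pos_and_logAC`;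
* `strictPos_of_le_log_two_half` — the unconditional part of `StrictPos` known today: `0 < ε a` for
  `0 < a ≤ (log 2)/2` (landed `strictArchimedeanBottom_proof` at the dyadic window + antitonicity of `ε`).

Axioms ⊆ {propext, Classical.choice, Quot.sound}.
-/

-- `Summit.RiemannHypothesis.RiemannHypothesis.…` repeats a namespace component by design (D-0017 layout).
set_option linter.dupNamespace false

noncomputable section

namespace Summit.RiemannHypothesis.RiemannHypothesis.Theorems.WeilWindowFlowGronwallLeakage

open Literature.NumberTheory.LFunctions
open Summit.RiemannHypothesis.RiemannHypothesis.Theses.WeilWindowFlow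
open Summit.RiemannHypothesis.Cruxes.GronwallLeakage.Negative

/-- **Calibration of `StrictPos`.** Strict positivity of the window bottom at every window `a > 0` is
equivalent to the Riemann hypothesis (`→`: Yoshida's criterion; `←`: `strictUnderRH_proof`). [folklore] -/
theorem strictPos_iff_riemannHypothesis :
    (∀ a : ℝ, 0 < a → 0 < weilGroundEnergy a) ↔ _root_.RiemannHypothesis := by
  constructor
  · intro h
    exact riemannHypothesis_iff_forall_weilPositivityOn.2 fun a ha ↦
      (weilGroundEnergy_nonneg_iff_holds ha).1 (h a ha).le
  · intro hRH a ha
    exact Summit.RiemannHypothesis.RiemannHypothesis.Theorems.strictUnderRH_proof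
      ((_root_.Summit.RiemannHypothesis_iff).2 hRH) a ha

/-- **The unconditional range of `StrictPos`.** For `0 < a ≤ (log 2)/2` the window bottom is strictly
positive: `0 < ε((log 2)/2) ≤ ε(a)` (`strictArchimedeanBottom_proof`, item 1042, and antitonicity). [folklore] -/
theorem strictPos_of_le_log_two_half {a : ℝ} (ha : 0 < a) (hle : a ≤ Real.log 2 / 2) :
    0 < weilGroundEnergy a :=
  lt_of_lt_of_le Summit.RiemannHypothesis.RiemannHypothesis.Theorems.strictArchimedeanBottom_proof
    (weilGroundEnergy_antitone_of_pos' ha hle)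

/-- **The crux, calibrated.** `GronwallLeakage ⟺ RH ∧ (log ε` absolutely continuous on every compact window
range `[b, a] ⊂ (0, ∞))` — the structure theorem `gronwallLeakage_iff_pos_and_logAC` with `StrictPos`
replaced by `RH` (`strictPos_iff_riemannHypothesis`). [folklore] -/
theorem gronwallLeakage_iff_riemannHypothesis_and_logAC :
    GronwallLeakage ↔
      _root_.RiemannHypothesis ∧
      (∀ b a : ℝ, 0 < b → b ≤ a →
        AbsolutelyContinuousOnInterval (fun x ↦ Real.log (weilGroundEnergy x)) b a) := by
  rw [gronwallLeakage_iff_pos_and_logAC, strictPos_iff_riemannHypothesis]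

end Summit.RiemannHypothesis.RiemannHypothesis.Theorems.WeilWindowFlowGronwallLeakage

end
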